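import Summits.PneNP.PneNP.Theorems.SliceACZero.Negative.LoadBearing

/-!
# `SliceACZero` (stmt-PneNP-2835) — negative-side lemmas I′: load-bearing clauses of the hypothesis;
# global corollaries

Continuation of `LoadBearing.lean`: `not_innerHypNoWindow` (`q = 0`, the gate-free `x_e`),
`not_innerHypNoBasis` (one CLIQUE gate at the central density); and the global corollaries — the
dropped-clause versions of conclusion and hypothesis are false outright (`not_concNoWindow`,
`not_concWindowAbove`, `not_concNoBasis`, `not_concNoError`, `not_hypNoWindow`, `not_hypNoBasis`).

Refuter seat cdisprove-stmt-PneNP-2835 (gen 1), 2026-08-16. In the docstrings, `InnerConc d c k δ` /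
`InnerHyp d c k δ` (and their `NoWindow`/`NoBasis`/… variants) denote the displayed inner clauses; they are
named predicates only in the work file `Summits/PneNP/PneNP/Cruxes/SliceACZero/Disproof.lean` (running
commentary: why the crux resists, what was not attempted) and are INLINED here.
-/

noncomputable section

namespace Summit.PneNP.PneNP.Theorems.SliceACZero.Negative

open Literature.Computability.Complexity Filter Finset
open Summit.PneNP.PneNP.Theses.OneSlice (SliceACZero)

/-! ### The same clauses on the hypothesis side -/

/-- At `q = 0` the `G(n,0)`-error of `x_e` against `CLIQUE_k` vanishes: the only vector of positive
weight is the empty graph, where both are `0`. [folklore] -/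
theorem gnpDisagreeProb_zero_input {n k : ℕ} (hk : 2 ≤ k) (e : (⊤ : SimpleGraph (Fin n)).edgeSet) :
    gnpDisagreeProb n 0 (Circuit.input e).eval (cliqueFn n k) = 0 := by
  rw [gnpDisagreeProb]
  refine Finset.sum_eq_zero fun x hx => ?_
  rw [Finset.mem_filter] at hx
  have hne : edgeCount x ≠ 0 := by
    intro h0
    have hx0 := eq_false_of_edgeCount_eq_zero h0
    subst hx0
    exact hx.2 (by rw [(input_facts e acBasis).2.2.2, cliqueFn_false hk])
  rw [gnpWeight, zero_pow hne, zero_mul]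

/-- **The `q`-window is load-bearing on the hypothesis side** — all `d, c`, `k ≥ 2`, `δ ≥ 0`: at
`q = 0` the random graph is empty a.s. and `x_e` (size `0`) is exact. [folklore] -/
theorem not_innerHypNoWindow (d c : ℕ) {k : ℕ} (hk : 2 ≤ k) {δ : ℝ} (hδ : 0 ≤ δ) :
    ¬ (∀ᶠ n : ℕ in atTop, ∀ q : ℝ, 0 ≤ q → q ≤ 1 →
        ∀ C : Circuit ((⊤ : SimpleGraph (Fin n)).edgeSet), C.IsOver acBasis → C.acDepth ≤ d →
          gnpDisagreeProb n q C.eval (cliqueFn n k) ≤ δ → n ^ c < C.size) := by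
  intro h
  obtain ⟨n, hn, hn2⟩ := (h.and (eventually_ge_atTop 2)).exists
  obtain ⟨e⟩ := exists_edge hn2
  obtain ⟨hB, hD, hS, -⟩ := input_facts e acBasis
  have herr : gnpDisagreeProb n 0 (Circuit.input e).eval (cliqueFn n k) ≤ δ := by
    rw [gnpDisagreeProb_zero_input hk e]
    exact hδ
  have := hn 0 le_rfl zero_le_one (Circuit.input e) hB (hD.trans_le (Nat.zero_le d)) herr
  rw [hS] at this
  exact Nat.not_lt_zero _ this

/-- **The basis restriction is load-bearing on the hypothesis side** — `d ≥ 1`, all `c`, `k ≥ 2`,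
`δ ≥ 0`: the one-gate CLIQUE circuit at the central density `q = m_k(n)/C(n,2)`. [folklore] -/
theorem not_innerHypNoBasis {d : ℕ} (hd : 1 ≤ d) (c : ℕ) {k : ℕ} (hk : 2 ≤ k) {δ : ℝ}
    (hδ : 0 ≤ δ) : ¬ (∀ᶠ n : ℕ in atTop, ∀ q : ℝ, 0 ≤ q → q ≤ 1 →
        |q * (n.choose 2 : ℕ) - (mk n k : ℝ)| ≤ (mk n k : ℝ) ^ ((3 : ℝ) / 4) →
        ∀ C : Circuit ((⊤ : SimpleGraph (Fin n)).edgeSet), C.acDepth ≤ d →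
          gnpDisagreeProb n q C.eval (cliqueFn n k) ≤ δ → n ^ c < C.size) := by
  intro h
  obtain ⟨n, hn, hn2⟩ := (h.and (eventually_ge_atTop 2)).exists
  obtain ⟨C, hS, hD, hE⟩ :=
    exists_oneGate_circuit ((⊤ : SimpleGraph (Fin n)).edgeSet) (cliqueFn n k)
  obtain ⟨hq0, hq1, hqw⟩ := centre_density hn2 hk
  have herr : gnpDisagreeProb n ((mk n k : ℝ) / (n.choose 2 : ℕ)) C.eval (cliqueFn n k) ≤ δ := by
    rw [gnpDisagreeProb_eq_zero_of_forall _ hE]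
    exact hδ
  have hlt := hn _ hq0 hq1 hqw C (hD.trans hd) herr
  rw [hS] at hlt
  exact absurd (Nat.one_le_pow c n (by omega)) (not_le.2 hlt)

/-! ### Global corollaries (the dropped-clause versions of `Conc` / `Hyp` are false outright) -/

/-- `Conc` without the window is false. [folklore] -/
theorem not_concNoWindow :
    ¬ ∀ d c : ℕ, ∃ k : ℕ, 3 ≤ k ∧ ∃ δ : ℝ, 0 < δ ∧ (∀ᶠ n : ℕ in atTop, ∀ j : ℕ,
        ∀ C : Circuit ((⊤ : SimpleGraph (Fin n)).edgeSet), C.IsOver acBasis → C.acDepth ≤ d →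
          (sliceErr n j C.eval (cliqueFn n k) : ℝ) ≤ δ * sliceCard n j → n ^ c < C.size) := fun h => by
  obtain ⟨k, hk, δ, hδ, hI⟩ := h 0 0
  exact not_innerConcNoWindow 0 0 (by omega) hδ.le hI

/-- `Conc` with the one-sided window `m_k(n) ≤ j` is false. [folklore] -/
theorem not_concWindowAbove :
    ¬ ∀ d c : ℕ, ∃ k : ℕ, 3 ≤ k ∧ ∃ δ : ℝ, 0 < δ ∧ (∀ᶠ n : ℕ in atTop, ∀ j : ℕ, mk n k ≤ j →
        ∀ C : Circuit ((⊤ : SimpleGraph (Fin n)).edgeSet), C.IsOver acBasis → C.acDepth ≤ d →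
          (sliceErr n j C.eval (cliqueFn n k) : ℝ) ≤ δ * sliceCard n j → n ^ c < C.size) := fun h => by
  obtain ⟨k, hk, δ, hδ, hI⟩ := h 1 0
  exact not_innerConcWindowAbove le_rfl 0 (by omega) hδ.le hI

/-- `Conc` without the basis restriction is false. [folklore] -/
theorem not_concNoBasis :
    ¬ ∀ d c : ℕ, ∃ k : ℕ, 3 ≤ k ∧ ∃ δ : ℝ, 0 < δ ∧ (∀ᶠ n : ℕ in atTop, ∀ j : ℕ, |(j : ℝ) - (mk n k : ℝ)| ≤ (mk n k : ℝ) ^ ((3 : ℝ) / 4) →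
        ∀ C : Circuit ((⊤ : SimpleGraph (Fin n)).edgeSet), C.acDepth ≤ d →
          (sliceErr n j C.eval (cliqueFn n k) : ℝ) ≤ δ * sliceCard n j → n ^ c < C.size) := fun h => by
  obtain ⟨k, -, δ, hδ, hI⟩ := h 1 0
  exact not_innerConcNoBasis le_rfl 0 k hδ.le hI

/-- `Conc` without the accuracy hypothesis is false. [folklore] -/
theorem not_concNoError :
    ¬ ∀ d c : ℕ, ∃ k : ℕ, 3 ≤ k ∧ ∃ δ : ℝ, 0 < δ ∧ (∀ᶠ n : ℕ in atTop, ∀ j : ℕ, |(j : ℝ) - (mk n k : ℝ)| ≤ (mk n k : ℝ) ^ ((3 : ℝ) / 4) →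
        ∀ C : Circuit ((⊤ : SimpleGraph (Fin n)).edgeSet), C.IsOver acBasis → C.acDepth ≤ d →
          n ^ c < C.size) := fun h => by
  obtain ⟨k, -, δ, -, hI⟩ := h 0 0
  exact not_innerConcNoError 0 0 k hI

/-- `Hyp` without the window is false. [folklore] -/
theorem not_hypNoWindow :
    ¬ ∀ d c : ℕ, ∃ k : ℕ, 3 ≤ k ∧ ∃ δ : ℝ, 0 < δ ∧ (∀ᶠ n : ℕ in atTop, ∀ q : ℝ, 0 ≤ q → q ≤ 1 →
        ∀ C : Circuit ((⊤ : SimpleGraph (Fin n)).edgeSet), C.IsOver acBasis → C.acDepth ≤ d →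
          gnpDisagreeProb n q C.eval (cliqueFn n k) ≤ δ → n ^ c < C.size) := fun h => by
  obtain ⟨k, hk, δ, hδ, hI⟩ := h 0 0
  exact not_innerHypNoWindow 0 0 (by omega) hδ.le hI

/-- `Hyp` without the basis restriction is false. [folklore] -/
theorem not_hypNoBasis :
    ¬ ∀ d c : ℕ, ∃ k : ℕ, 3 ≤ k ∧ ∃ δ : ℝ, 0 < δ ∧ (∀ᶠ n : ℕ in atTop, ∀ q : ℝ, 0 ≤ q → q ≤ 1 →
        |q * (n.choose 2 : ℕ) - (mk n k : ℝ)| ≤ (mk n k : ℝ) ^ ((3 : ℝ) / 4) →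
        ∀ C : Circuit ((⊤ : SimpleGraph (Fin n)).edgeSet), C.acDepth ≤ d →
          gnpDisagreeProb n q C.eval (cliqueFn n k) ≤ δ → n ^ c < C.size) := fun h => by
  obtain ⟨k, hk, δ, hδ, hI⟩ := h 1 0
  exact not_innerHypNoBasis le_rfl 0 (by omega) hδ.le hI

end Summit.PneNP.PneNP.Theorems.SliceACZero.Negative

end
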